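/-
Copyright (c) 2026 the pub-hodgecm-mathlib formalisation cell (harness21).  Prover seat hodgecm-mathlib-LH7-p06 (g2) (LH7 hand lent to L1; U1 END pen ∕ desk K2E3-p06 (g6)
deal (F-loc) 00:32:01Z; LEAD F0P6-plan (g15) BATCH #187), Track B "K2-LIT" ∕ hLiu418 = stmt-HodgeConjecture-24832: U1-CT-ind stage 3 ("U1-glob"), LEVEL 2-fin at the kernel
place `v₀` — THE LOCAL VALUE `Fn = κ·N₃(·, h_{v₀})`: holomorphic on `0 < re s`, DEAD AT `½`, and equal to ★ FILE 2's local factor on `1 < re s`.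
THEOREMS ONLY (no `def`∕`instance`∕notation∕`sorry`).
-/
import Summits.HodgeConjecture.HodgeConjecture.Theorems.K2LiuLocalKernelN3ReadingCarrier      -- ★ p863584 (this seat): `localKernelN3_half_eq_zero_unipDeltaLoc_cm` (brings ★ FILE A∕B)
import Summits.HodgeConjecture.HodgeConjecture.Theorems.K2LiuCMRankOneFrameOfRecord            -- ★ B2a-inst p863571 (K2E3-p06): `exists_cmFrame_coordTwo`, `exists_conductor_letter_chiF_localComponent`; brings ★ TailGlue
import Summits.HodgeConjecture.HodgeConjecture.Theorems.K2LiuKindOneSingularCornerTraceLetter   -- ★ (K2E3-p06): `cornerTrace_ne_zero`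
import Literature.NumberTheory.Automorphic.AdeleAddCharLocalNontrivial                          -- ★ `isContinuousNontrivial_adeleAddCharAt` (a conductor exponent for `ψ_{L⁺,v₀}`)
import HarnessLib

/-!
# Crux `HLiu418`, organ U1-CT-ind STAGE 3 ("U1-glob"), LEVEL 2-fin at the kernel place — (F-loc) THE LOCAL VALUE AT `v₀` IS DEAD AT `½`
# [KudlaRallis1994 §2; KudlaSweet1997 §1; Casselman1980 §3 Thm. 3.1; CasselmanShalika1980 §4; Tan1999 §3; HarrisKudlaSweet1996 §1]

Cell `hodgecm-mathlib`, crux item hLiu418 = `stmt-HodgeConjecture-24832`; squad K2, strike line L1, LEAD F0P6-plan (g15) BATCH #187; U1 END pen ∕ desk K2E3-p06 (g6)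
(deal (F-loc) 00:32:01Z); prover LH7-p06 (g2).  Lane `--supports stmt-HodgeConjecture-24832 --as helper` (count-neutral).

THE SLOT.  The END assembler `K2LiuLocalKernelPlacePackageFinite.hplace_of_localKernel_finite` (K2E3-p06) needs, at the kernel place `v₀` of the K2Lit CM doubled datum
(`F = L⁺`, `E = L`, `c = complexConj`, `δ = imagUnit`, `T₂ = gramR`, `J₂D = hermD`, rank `n = 2`), for the flat family `bT` of smooth Siegel sections through the kernel
vector (★ B2b FILE 3), the corner index `X = single 1 1 σ` (`σ` imaginary, `σ ≠ 0`; ★ (K1a-1) dress) and a point `h_{v₀}`:  a function `Fn : ℂ → ℂ` with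
(1) `Fn` holomorphic on `{0 < re s}`;  (2) **`Fn(½) = 0`**;  (3) on `1 < re s`, `∫_{N_Δ(L⁺_{v₀})} conj ψ_X(ι_{v₀} y) · bT_s((w_Δ)_{v₀}·y·h_{v₀}) dνN(y) = Fn(s)` — the `_hloc` binder of
K2E3-p28's `exists_kernelPlace_tailPackage` TOKEN FOR TOKEN (at `n := 2`, `S := single 1 1 σ`, the point a letter).

THE PROOF (`exists_localValue_dead_at_half`) — pure assembly of ★ names: the frame and coordinates of record ★ B2a-inst `exists_cmFrame_coordTwo` (`D Dinv Q e3 …`, with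
`Dinv = 2·W·gramR`); `ψ := ψ_{L⁺,v₀} = adeleAddCharAt (Fp L) v₀` (continuous, with a conductor exponent: ★ `isContinuousNontrivial_adeleAddCharAt`); the corner scalar
`σ' := −ι_{v₀}(gramR 1 1 · Tr_{L∕L⁺}(σ·δ_L)) ≠ 0` (★ `cornerTrace_ne_zero`); additive Haar measures `μF, μw` (`Measure.addHaar`); then ★ TailGlue §5-full
`exists_localFactor_reading_of_hchar_full` with §4's dictionary `hchar_corner_of_record` gives ★ p862989's tuple `(A, N₁, N₂, N₃, κ)` ON `unipDeltaLoc v₀` with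
(ii) `s ↦ κ(s)·N₃(s,h)` holomorphic on `{0 < re}` and (iii) = the local factor against the GLOBAL character `conj ψ_X(ι_{v₀}·)`; the conductor letter of `χ_{F,v₀}`
★ `exists_conductor_letter_chiF_localComponent`; and ★ carrier §2 `localKernelN3_half_eq_zero_unipDeltaLoc_cm` (⟸ ★ FILE B ⟸ ★ FILE A ⟸ ★ W-FE-3∕4, ★ B7) with U1's
finite clause `hU1` (RULING M-157q (r3): THE hypothesis of U1-glob at `(bT, νN, K₀)`) kills `N₃(½, ·)`.  `Fn := fun s => κ s * N₃ s h_{v₀}`.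
References: [KudlaRallis1994] S. Kudla, S. Rallis, Ann. of Math. 140 (1994), §2; [KudlaSweet1997] S. Kudla, W. J. Sweet, Israel J. Math. 98 (1997), §1;
[Casselman1980] W. Casselman, Compositio Math. 40 (1980), §3 Thm. 3.1; [CasselmanShalika1980] W. Casselman, J. Shalika, Compositio Math. 41 (1980), §4;
[Tan1999] V. Tan, Israel J. Math. 110 (1999), §3; [HarrisKudlaSweet1996] M. Harris, S. Kudla, W. J. Sweet, J. AMS 9 (1996), §1 (1.11)–(1.15).
HONEST LABEL.  Count-neutral helper: `HC_CM` is proved only modulo the 7 printed citations (2 remaining named inputs: hLiu418 = `stmt-HodgeConjecture-24832`,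
h413 = `stmt-HodgeConjecture-24833`) until rung 0 closes; this file closes no socket — it is the (F-loc) input of the LEVEL 2-fin assembler, modulo `hU1` (U1-glob).
-/

set_option autoImplicit false
set_option linter.dupNamespace false -- the mandated namespace repeats `HodgeConjecture.HodgeConjecture`

noncomputable section

open scoped Classical NNReal ENNReal ComplexConjugate
open NumberField IsDedekindDomain Matrix MeasureTheory Topology
open Literature.NumberTheory.GaloisRepresentations Literature.NumberTheory.GaloisRepresentations.IsNonarchimedeanLocalField
open Literature.NumberTheory.Automorphic Literature.NumberTheory.Automorphic.UnitaryGroup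
open Literature.NumberTheory.GelbartRogawski1991 Literature.NumberTheory.GelbartRogawski1991.GRConstruction
open Literature.NumberTheory.GelbartRogawski1991.UnitaryDualPair
open Literature.NumberTheory.GelbartRogawski1991.AdaptedBlocks
open Literature.NumberTheory.GelbartRogawski1991.UnitaryDualPair.LocalSplitting
open Literature.NumberTheory.K2Lit.LocalSiegelDoubled
open Summit.HodgeConjecture.HodgeConjecture.Cruxes.HLiu418.K2LiuQRationalDefs
open Summit.HodgeConjecture.HodgeConjecture.Cruxes.HLiu418.K2LiuLocalLFactorDefs
open Summit.HodgeConjecture.HodgeConjecture.Cruxes.HLiu418.K2LiuLocalSiegelIwasawaFrame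
open Summit.HodgeConjecture.HodgeConjecture.Cruxes.HLiu418.K2LiuLocalSiegelIwasawa
open Summit.HodgeConjecture.HodgeConjecture.Cruxes.HLiu418.K2LiuDoubledUTwoTwoBorelFrame
open Summit.HodgeConjecture.HodgeConjecture.Cruxes.HLiu418.K2LiuDoubledUTwoTwoFrameTransport
open Summit.HodgeConjecture.HodgeConjecture.Cruxes.HLiu418.K2LiuDoubledUTwoTwoUnipotentCoordinates
open Summit.HodgeConjecture.HodgeConjecture.Cruxes.HLiu418.K2LiuUnipDeltaRankOneCoordinates
open Summit.HodgeConjecture.HodgeConjecture.Cruxes.HLiu418.K2LiuSiegelCocycleLetters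
open Summit.HodgeConjecture.HodgeConjecture.Cruxes.HLiu418.K2LiuFlatSiegelFamilies
open Summit.HodgeConjecture.HodgeConjecture.Cruxes.HLiu418.K2LiuSiegelUnipotentLocalDefs (unipDeltaLoc)
open Summit.HodgeConjecture.HodgeConjecture.Cruxes.HLiu418.K2LiuSiegelUnipotentFourierDefs (unipDeltaChar)
open Summit.HodgeConjecture.HodgeConjecture.Cruxes.HLiu418.K2LiuSingularWhittakerTailGlue (hchar_corner_of_record exists_localFactor_reading_of_hchar_full)
open Summit.HodgeConjecture.HodgeConjecture.Cruxes.HLiu418.K2LiuCMRankOneFrameOfRecord (exists_cmFrame_coordTwo exists_conductor_letter_chiF_localComponent)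
open Summit.HodgeConjecture.HodgeConjecture.Cruxes.HLiu418.K2LiuKindOneSingularCornerTraceLetter (cornerTrace_ne_zero)
open Summit.HodgeConjecture.HodgeConjecture.Cruxes.HLiu418.K2LiuLocalKernelN3ReadingCarrier (localKernelN3_half_eq_zero_unipDeltaLoc_cm)

namespace Summit.HodgeConjecture.HodgeConjecture.Cruxes.HLiu418.K2LiuLocalKernelLocalValueAtKernelPlace

variable (L : Type) [Field L] [NumberField L] [IsCMField L] {N M : ℕ} (e : Fin N × Fin M ≃ Fin 2)
  (dV : Fin N → L) (hdV : ∀ i, IsCMField.complexConj L (dV i) = dV i) (dW : Fin M → L) (hdW : ∀ i, IsCMField.complexConj L (dW i) = dW i)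
  (v₀ : HeightOneSpectrum (𝓞 (Fp L)))

set_option maxHeartbeats 800000 in -- MEASURED 2026-09-05: 200 000 ✗, 400 000 ✗ (`whnf` on the statement ∕ the two applications at the K2Lit CM telescope, ★ TailGlue §3's class), 800 000 ✓; `obtain`∕`exact` only
/-- **(F-loc) THE LOCAL VALUE AT THE KERNEL PLACE IS HOLOMORPHIC ON `0 < re s`, DEAD AT `½`, AND IS THE LOCAL FACTOR.**  At the K2Lit CM doubled datum of rank `2` (`dV i ≠ 0`,
`dW i ≠ 0`), a finite place `v₀` with ONE place `w` of `L` above it, any Haar measure `νN` on `unipDeltaLoc v₀`, the local components `χ_v` of a Hecke character (unitary: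
`hχ`), a compact open `K₀` with the local Iwasawa property, a `K₀`-flat family `bT` of smooth Siegel sections of `I_{v₀}(s, χ_v)`, an imaginary non-zero corner entry `σ` and a
point `h_{v₀}`: GIVEN U1's finite clause `hU1` at `(bT, νN, K₀)` there is `Fn : ℂ → ℂ`, holomorphic on `{0 < re s}`, with **`Fn (1/2) = 0`** and
`∫ conj ψ_{single 1 1 σ}(ι_{v₀} y) · bT_s((w_Δ)_{v₀}·y·h_{v₀}) dνN(y) = Fn s` for `1 < re s` (K2E3-p28's `_hloc` binder at `n = 2`, `S = single 1 1 σ`).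
[cite: KudlaRallis1994, §2] [cite: KudlaSweet1997, §1] [cite: Casselman1980, §3 Thm. 3.1] [cite: CasselmanShalika1980, §4] [cite: Tan1999, §3] -/
theorem exists_localValue_dead_at_half (hdV0 : ∀ i, dV i ≠ 0) (hdW0 : ∀ i, dW i ≠ 0)
    [MeasurableSpace (unipDeltaLoc L e dV hdV dW hdW v₀)] [BorelSpace (unipDeltaLoc L e dV hdV dW hdW v₀)]
    (νN : Measure (unipDeltaLoc L e dV hdV dW hdW v₀)) [νN.IsHaarMeasure]
    (χ : HeckeCharacter L) (hχ : ∀ (w' : PlacesOver L v₀) (x : (w'.1.adicCompletion L)ˣ), ‖((χ.localComponent w'.1 x : ℂˣ) : ℂ)‖ = 1)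
    (K₀ : Subgroup (UnitaryGroup.localPi L (IsCMField.complexConj L) (2 + 2) (hermD L e dV hdV dW hdW) v₀))
    (hK₀ : IsCompact (K₀ : Set (UnitaryGroup.localPi L (IsCMField.complexConj L) (2 + 2) (hermD L e dV hdV dW hdW) v₀)) ∧ IsOpen (K₀ : Set (UnitaryGroup.localPi L (IsCMField.complexConj L) (2 + 2) (hermD L e dV hdV dW hdW) v₀)))
    (hIw : haveI : Algebra.IsQuadraticExtension (Fp L) L := IsCMField.isQuadraticExtension L
      ∀ g : UnitaryGroup.localPi L (IsCMField.complexConj L) (2 + 2) (hermD L e dV hdV dW hdW) v₀, ∃ p, IsSiegelDelta (Fp L) L (IsCMField.complexConj L) (complexConj_imagUnit L) (imagUnit_ne_zero L) (imagUnit_mul_self L) v₀ 2 (gramR_isSymm L e dV hdV dW hdW) (hermD_eq_map_gramD L e dV hdV dW hdW) p ∧ ∃ k ∈ K₀, g = p * k)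
    (bT : ℂ → UnitaryGroup.localPi L (IsCMField.complexConj L) (2 + 2) (hermD L e dV hdV dW hdW) v₀ → ℂ)
    (hSieg : haveI : Algebra.IsQuadraticExtension (Fp L) L := IsCMField.isQuadraticExtension L
      ∀ s, IsLocalSiegelSection (Fp L) L (IsCMField.complexConj L) (complexConj_imagUnit L) (imagUnit_ne_zero L) (imagUnit_mul_self L) v₀ 2 (gramR_isSymm L e dV hdV dW hdW) (hermD_eq_map_gramD L e dV hdV dW hdW)
        (fun w => χ.localComponent w.1) s (bT s))
    (hsm : ∀ s, IsSmooth (Fp L) L (IsCMField.complexConj L) v₀ 2 (bT s))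
    (hflat : ∀ s s' : ℂ, ∀ k ∈ K₀, bT s k = bT s' k)
    (w : PlacesOver L v₀) (hw : ∀ w' : PlacesOver L v₀, w' = w)
    (σ : L) (hσc : IsCMField.complexConj L σ = -σ) (hσ0 : σ ≠ 0)
    (hv : UnitaryGroup.localPi L (IsCMField.complexConj L) (2 + 2) (hermD L e dV hdV dW hdW) v₀)
    -- U1's finite clause at this family ON `unipDeltaLoc v₀` (RULING M-157q (r3); the bytes of ★ carrier §2)
    (hU1 : haveI : Algebra.IsQuadraticExtension (Fp L) L := IsCMField.isQuadraticExtension L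
      ∀ Fn : ℂ → UnitaryGroup.localPi L (IsCMField.complexConj L) (2 + 2) (hermD L e dV hdV dW hdW) v₀ → ℂ,
      (∀ s : ℂ, 1 < s.re → ∀ h : UnitaryGroup.localPi L (IsCMField.complexConj L) (2 + 2) (hermD L e dV hdV dW hdW) v₀,
        ∫ u : unipDeltaLoc L e dV hdV dW hdW v₀, bT s (UnitaryGroup.evalPlace (Fp L) L (IsCMField.complexConj L) (2 + 2) (hermD L e dV hdV dW hdW) v₀ (UnitaryGroup.finPart (Fp L) L (IsCMField.complexConj L) (2 + 2) (hermD L e dV hdV dW hdW) (Literature.NumberTheory.K2Lit.SiegelDoubled.weylDelta L e dV hdV dW hdW)) * (u : UnitaryGroup.localPi L (IsCMField.complexConj L) (2 + 2) (hermD L e dV hdV dW hdW) v₀) * h) ∂νN =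
          aNorm (Fp L) L (IsCMField.complexConj L) v₀ 2 (fun w => χ.localComponent w.1) (νN.real {u : unipDeltaLoc L e dV hdV dW hdW v₀ | (u : UnitaryGroup.localPi L (IsCMField.complexConj L) (2 + 2) (hermD L e dV hdV dW hdW) v₀) ∈ K₀}) s * Fn s h) →
      (∀ h : UnitaryGroup.localPi L (IsCMField.complexConj L) (2 + 2) (hermD L e dV hdV dW hdW) v₀, IsQRationalRegularAt (residueFieldCard (v₀.adicCompletion (Fp L))) (1 / 2) (fun s => Fn s h)) →
      ∀ h : UnitaryGroup.localPi L (IsCMField.complexConj L) (2 + 2) (hermD L e dV hdV dW hdW) v₀, Fn (1 / 2) h = 0) :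
    ∃ Fn : ℂ → ℂ, DifferentiableOn ℂ Fn {s : ℂ | 0 < s.re} ∧ Fn (1 / 2) = 0 ∧
      ∀ s : ℂ, 1 < s.re →
        ∫ y, conj (unipDeltaChar L e dV hdV dW hdW (Matrix.single 1 1 σ)
              (locToAdelic L e dV hdV dW hdW v₀ (y : UnitaryGroup.localPi L (IsCMField.complexConj L) (2 + 2) (hermD L e dV hdV dW hdW) v₀)) : ℂ) *
            bT s (UnitaryGroup.evalPlace (Fp L) L (IsCMField.complexConj L) (2 + 2) (hermD L e dV hdV dW hdW) v₀ (UnitaryGroup.finPart (Fp L) L (IsCMField.complexConj L) (2 + 2) (hermD L e dV hdV dW hdW) (Literature.NumberTheory.K2Lit.SiegelDoubled.weylDelta L e dV hdV dW hdW)) * (y : UnitaryGroup.localPi L (IsCMField.complexConj L) (2 + 2) (hermD L e dV hdV dW hdW) v₀) * hv) ∂νN = Fn s := by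
  haveI : Algebra.IsQuadraticExtension (Fp L) L := IsCMField.isQuadraticExtension L
  -- the frame and the coordinates of record at `v₀` (★ B2a-inst)
  obtain ⟨D, Dinv, Q, e3, hDD, hQm, hQ, -, hDinv, he3, he3mul⟩ := exists_cmFrame_coordTwo L e dV hdV hdV0 dW hdW hdW0 v₀
  -- additive Haar measures on `L⁺_{v₀}` and `L_w`
  borelize (v₀.adicCompletion (Fp L)) (w.1.adicCompletion L)
  obtain ⟨μF, hμF⟩ : ∃ μ : Measure (v₀.adicCompletion (Fp L)), μ.IsAddHaarMeasure := ⟨Measure.addHaar, inferInstance⟩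
  obtain ⟨μw, hμw⟩ : ∃ μ : Measure (w.1.adicCompletion L), μ.IsAddHaarMeasure := ⟨Measure.addHaar, inferInstance⟩
  -- Tate's character at `v₀`, its conductor exponent; the corner scalar `σ' ≠ 0`; the conductor letter of `χ_{F,v₀}`
  have hψ : Continuous (adeleAddCharAt (Fp L) v₀) := continuous_adeleAddCharAt (Fp L) v₀
  obtain ⟨mψ, hmψ⟩ := (isContinuousNontrivial_adeleAddCharAt (Fp L) v₀).exists_hasConductorExp
  have hσ' : -(algebraMap (Fp L) (v₀.adicCompletion (Fp L)) (gramR L e dV hdV dW hdW 1 1 * Algebra.trace (Fp L) L (σ * imagUnit L))) ≠ 0 :=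
    neg_ne_zero.2 ((_root_.map_ne_zero _).2 (cornerTrace_ne_zero L e dV hdV hdV0 dW hdW hdW0 hσ0 hσc))
  obtain ⟨cν, hνc⟩ := exists_conductor_letter_chiF_localComponent L χ v₀
  -- ★ TailGlue §5-full with §4's dictionary for the corner of record: the whole tuple on `unipDeltaLoc v₀`
  have h₀ := exists_localFactor_reading_of_hchar_full L e dV hdV dW hdW v₀ D Dinv hDD Q hQm hQ νN μF (fun w => χ.localComponent w.1) hχ K₀ hK₀
  have h₁ := h₀ hIw bT
  have h₂ := h₁ hSieg
  have h₃ := h₂ hsm hflat e3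
  have h₄ := h₃ he3
  have h₅ := h₄ he3mul (adeleAddCharAt (Fp L) v₀) hψ hmψ hσ' w hw μw (Matrix.single 1 1 σ)
  obtain ⟨A, N₁, N₂, N₃, κ, hA, hN₂reg, hN₃reg, -, hdiff, hloc, htw, -, hform, -⟩ :=
    h₅ (hchar_corner_of_record L e dV hdV dW hdW v₀ D Dinv hDD Q hQm hQ hDinv e3 he3 σ)
  -- the dead value (★ carrier §2 ⟸ ★ FILE B ⟸ ★ FILE A), `hU1` the hypothesis
  have d₀ := localKernelN3_half_eq_zero_unipDeltaLoc_cm L e dV hdV dW hdW v₀ D Dinv hDD Q hQm hQ νN μF (fun w => χ.localComponent w.1) hχ K₀ hK₀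
  have d₁ := d₀ hIw bT
  have d₂ := d₁ hSieg
  have d₃ := d₂ hsm hflat e3
  have d₄ := d₃ he3
  have d₅ := d₄ he3mul (adeleAddCharAt (Fp L) v₀) hψ hmψ hσ' w hw μw A hA N₁ N₂ N₃ hN₂reg hN₃reg
  have d₆ := d₅ htw
  have d₇ := d₆ hform cν hνc
  have hdead : ∀ h : UnitaryGroup.localPi L (IsCMField.complexConj L) (2 + 2) (hermD L e dV hdV dW hdW) v₀, N₃ (1 / 2) h = 0 := d₇ hU1
  exact ⟨fun s => κ s * N₃ s hv, hdiff hv, by simp only [hdead hv, mul_zero], fun s hs => hloc s hs hv⟩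

end Summit.HodgeConjecture.HodgeConjecture.Cruxes.HLiu418.K2LiuLocalKernelLocalValueAtKernelPlace

end
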